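import Summits.ResolutionOfSingularities.ResolutionOfSingularities.Theorems.DeltaCutSingCells
import Literature.AlgebraicGeometry.Resolution.StrictNormalCrossings
import HarnessLib

/-!
# DeltaCutStellar — tree file 1/2 of the decomp-res lens-6 g32 node «StellarCut» (barrier-complement carving):
# §NCStage (the letters), §NCTransport, §NCRing; file 2/2 `DeltaCutStellarCells` = §NCCells (cells, carve, edges)

Target (located residual of the column `E1TopNoAbs`, item 26971; live aside `GCE1TopGHeavy`, item 27045):
`E1TopSHeavy = E1TopSFrozen ∧ E1TopSPerpetual` (g30 `e1TopSHeavy_iff_singSing_perpetual`; kind F-ss² inhabited by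
T₃ = `z³ + (tuw)⁴`, char 3; kind P‴ inhabited by D₀ = `(x², z⁶w⁶)` and D₁ = `(x², z⁴w²)`, char 2 — g31 «NerveCut»).

THE BARRIER CARVED ALONG (lens-6): g31's Theorem B (`SRound.no_termination_measure`, `SRound.D0_unbounded`,
`SRound.periodic_orbit`) — SMALL-CENTRE («singular locus of the configuration first») laws stall (triple points, F-ss²) or diverge
(double curves, P‴) on labelled normal-crossings MONOMIAL square-contact configurations, dim 4, char `p ∣ n`; class
`Literature.Barriers.ResolutionOfSingularities.StratumFirstInvIncrease`.  ITS COMPLEMENT BY CONSTRUCTION: laws whose centres are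
WHOLE FACES `H ∩ ⋂_{i ∈ F} Dᵢ` of the labelled complex (minimal permissible faces: the Γ-law of the monomial case of
Encinas–Villamayor), which TERMINATE on every labelled complex — g31 Theorem A `Nerve.no_infinite_minPlay` (kernel, list level).

THIS NODE (0 sorry; imports LANDED Theorems + Literature only):
* §NCStage — THE NEW SCHEME-LEVEL LETTERS.  An n.c. FRAME on a stage `(Y, 𝓘)` is `(H; D₁ … D_r; a₁ … a_r)` with `H ∪ ⋃ Dᵢ` a
  strict normal crossings divisor (`IsStrictNormalCrossingsDivisor`, de Jong 2.4) whose irreducible components are exactly `H` and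
  the `Dᵢ`.  `IsNCStage n N` — THE IDEAL SHAPE `𝓘 = 𝓘(H)ⁿ + Π 𝓘(Dᵢ)^{aᵢ}` (D₀ = `(x)² + (z)⁶(w)⁶`, D₁): THE DOMAIN OF THE g33
  TRANSFER LEMMA («the singular run of an ideal-shape n.c. `IsBase` stage IS `SRound.sRound` on the label list»).  It is STABLE
  under the blow-up of any face with `Σ_F aᵢ ≥ n` (desk, all charts: `hⁿ ∈ 𝓘` gives `1 ∈ 𝓘′` on the `H`-chart and `h′ⁿ ∈ 𝓘′`
  elsewhere, `𝓘′ = 𝓘(H′)ⁿ + 𝓘(E)^{Σ_F aᵢ − n}·Π 𝓘(Dᵢ′)^{aᵢ}` — SQUARE CONTACT IS PERMANENT CONTACT in the ideal shape; the label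
  rule `Supp(𝓘, n) = H ∩ {y | Σ_{Dᵢ ∋ y} aᵢ ≥ n}`); NOT proved here.  `IsNCHypStage n N` — THE HYPERSURFACE SHAPE «stalk-locally
  along `H`, `𝓘_y = (hⁿ + u·m)`, `u` a unit, `(h) = 𝓘(H)_y`, `(m) = (Π 𝓘(Dᵢ)^{aᵢ})_y`, and `Supp(𝓘, n) ⊆ H`» (T₃ = `z³ + 1·(tuw)⁴`;
  `x² + t·z⁶w⁶` with `T : 1`): KANGAROO-PRONE — it is NOT stable under face blow-ups: DESK NEGATIVE (char 2, `n = 2`)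
  `f = x² + (1 + xz)·z²w²`, frame `(V(x); Z:2, W:2)`, `Supp = V(x) ∩ V(zw)`; blowing up the face `V(x, z)` (`a_E = 0`), the
  `x`-chart controlled transform `f₁ = 1 + z₁²w² + x₁²z₁³w² = (1 + z₁w)² + x₁²·z₁³w²` lies in `(x₁, 1 + z₁w)²`
  (`kangaroo_ring_cert`), so the top locus of the transform contains the surface `{x₁ = 0, z₁w = 1} ⊂ E ∖ H′`, carried by the NEW
  contact hypersurface `V(1 + z₁w)` and invisible to the labels — square contact is NOT permanent in the hypersurface shape
  (a Narasimhan/Moh-type jump at a label-`0` birth).  `IsNCRegime = IsNCStage ∨ IsNCHypStage`; `EverNC n R`: SOME level of the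
  singular run of `R` is in the n.c. regime.
* §NCTransport — `wor_of_wor_at_sRun`: a weak resolution of the datum found at ANY level `i` of the singular run of a base
  `n`-datum yields one of the datum (induction on `i` over the splice of `sHop_facts`; generalises g30's `wor_of_sTerminatesAt`;
  hypothesis-free — no `E 5`); `wor_of_ever`: with a law for a class of stages, entering the class at some level suffices.
* §NCCells — cells and the carve, ALL HYPOTHESIS-FREE:
  `WORNC n` [UNDECIDED · ATTACKABLE — the barrier's complement]: every base `n`-datum that IS an ideal-shape n.c. stage has a weak
  resolution (attack: the min-face law; list-level termination = g31 Theorem A; missing: the scheme ↔ nerve transfer, g33);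
  `WORNCHyp n` [UNDECIDED · IDEA-NEEDED]: the same for the hypersurface shape (contains T₃; the face law meets kangaroo births —
  a frame-change theory is needed; NOT claimed to lie outside Narasimhan's barrier);
  `WORTopSHeavyNC n` [UNDECIDED; ⟸ `WORNC ∧ WORNCHyp` by transport]: the residual's data entering the n.c. regime (T₃, D₀, D₁);
  `WORTopSHeavyOffNC n` ⟺ `WORTopSFrozenOffNC n ∧ WORTopSPerpetualOffNC n` [RESIDUAL remainders: the run NEVER enters the regime];
  `NCEntryPerpetual n` [UNDECIDED · the TEST-bearing structural conjecture: every P‴ datum's singular run ENTERS the n.c. regime —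
  it makes `WORTopSPerpetualOffNC n` VACUOUS; D₀, D₁, `x² + t·z⁶w⁶` enter at level `0`, `(x², (z² − w³)⁴)` at level `3` (paper)];
  EXACT: `worTopSHeavy_iff_nc_offNC : WORTopSHeavy n ⟺ WORTopSHeavyNC n ∧ WORTopSHeavyOffNC n`;
  THE CARVE: `worTopSHeavy_of_nc : WORNC n → WORNCHyp n → NCEntryPerpetual n → WORTopSFrozenOffNC n → WORTopSHeavy n`, family
  versions, and the edges `e1TopGHeavy_of_nc (h5 : E 5)` (aside 27045), `e1TopNoAbs_of_nc (hSC) (h5)` (item 26971), `e_one_of_nc`.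
* §NCRing — ring-level shape presentations of D₀, D₁, T₃ and the kangaroo certificate (0-currency documentation).

WHY EACH PIECE IS STRICTLY WEAKER THAN THE TARGET.  `WORNC n`, `WORNCHyp n`: statements about two thin SUB-CLASSES of stages
(labelled n.c. monomial square-contact, ideal / hypersurface shape), each containing TAME members decided mod `E 5` and missing
every datum whose run never enters the regime; `NCEntryPerpetual n`: a structural statement about the singular run with NO
resolution content; `WORTopSFrozenOffNC n`: the sub-cell of F-ss² MISSING its recorded inhabitant T₃ (hypersurface-n.c. at its
frozen level `0`; PAPER candidate inhabitant `(x², (z²w² − y⁵)²)`, char 2 — NOT claimed).  Jointly they give the target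
(`worTopSHeavy_of_nc`, kernel).  No EQUIV between a piece and the target is claimed; the only iffs are the exact cell splits.

WHY NOVEL.  First scheme-level typing, in this column, of the normal-crossings monomial square-contact regime of WILD (`p ∣ n`, no
absolute maximal contact) marked ideals, separating the IDEAL SHAPE — where the square-contact hypersurface `H` is a PERMANENT
contact hypersurface (`hⁿ ∈ 𝓘`) replacing the maximal contact that fails in characteristic `p`, so that the min-face law is by
construction outside the Sing-first barrier, outside Narasimhan's and outside the residual-order barriers — from the HYPERSURFACE
SHAPE, where the desk negative above shows the contact jumping at a label-`0` birth; the first transport of weak resolutions from an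
ARBITRARY level of the canonical singular run; and a carve placing every recorded residual inhabitant (T₃, D₀, D₁) in a typed cell.

HONEST CEILING.  Nothing here bounds a run or proves a law at scheme level; the letters' scheme-level instances at D₀/T₃ are part of
the transfer layer (ring-level presentations: §NCRing); `NCEntryPerpetual` may FAIL — a refutation is a NEW KIND «off-n.c. perpetual»
re-locating the residual to `WORTopSPerpetualOffNC`.  Barrier placement, tests and the g33 plan: HOME `decomp-res-lens-6/g32/NODE-g32.md`.

Sources: EncinasVillamayor2000 (good points and constructive resolution; the monomial case and the function Γ); BierstoneMilman1997
(canonical desingularization, invariant with exceptional-divisor memory); CossartJannsenSaito2020 (embedded resolution of excellent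
surfaces with boundary); Narasimhan1983 and Moh1987 (no maximal contact / residual-order jumps in char `p`); Hauser2010 (kangaroo
points); DeJong1996 2.4 (strict normal crossings); the column files `DeltaCutSing*`, `DeltaCutNerve*` (g30/g31). [new] [folklore]
-/

noncomputable section

open CategoryTheory CategoryTheory.Limits AlgebraicGeometry TopologicalSpace IsLocalRing
open Literature.AlgebraicGeometry.Resolution

namespace Summit.ResolutionOfSingularities.ResolutionOfSingularities.Theorems.DeltaCutClasses

open Summit.ResolutionOfSingularities.ResolutionOfSingularities.Theorems.TwistCutClasses
open Summit.ResolutionOfSingularities.ResolutionOfSingularities.Theorems.LightCutClasses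

section NCStage

open Summit.ResolutionOfSingularities.ResolutionOfSingularities.Theorems
open WeakOrderReduction ForcedTowerClasses SubfieldContactClasses AbsoluteContactClasses PurityValveClasses
open Scheme.IdealSheafData (vanishingIdeal)

/-! ### §NCStage — THE LETTERS: labelled normal-crossings monomial square-contact stages (ideal and hypersurface shape) -/

/-- **An n.c. FRAME on a stage** `N = (Y, 𝓘)`: a closed subset `H` (the square-contact hypersurface), `r` closed subsets
`D₁ … D_r` (the boundary components) and labels `a₁ … a_r : ℕ`.  Pure DATA; the conditions are the predicates below.
DEFINITION (letter, data). -/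
structure NCFrame (N : Stage) where
  /-- the square-contact hypersurface `H` -/
  H : Closeds N.Y
  /-- the number of boundary components -/
  r : ℕ
  /-- the boundary components `D₁ … D_r` -/
  D : Fin r → Closeds N.Y
  /-- the labels `a₁ … a_r` -/
  a : Fin r → ℕ

namespace NCFrame

variable {N : Stage}

/-- the MONOMIAL IDEAL SHEAF `𝓜 = Π 𝓘(Dᵢ)^{aᵢ}` of a frame (reduced ideal sheaves of the components, powers and product in the
idempotent semiring of ideal sheaves). DEFINITION (letter). -/
def boundary (F : NCFrame N) : N.Y.IdealSheafData := ∏ i, (vanishingIdeal (F.D i)) ^ (F.a i)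

/-- `F.IsSNC` — the frame is a STRICT NORMAL CROSSINGS configuration: `H ∪ ⋃ Dᵢ` is a strict normal crossings divisor of `Y`
(de Jong 1996, 2.4: `IsStrictNormalCrossingsDivisor`), and `H`, `D₁ … D_r` are irreducible and mutually NON-CONTAINED (so they are
exactly its irreducible components: regular divisors meeting like coordinate hyperplanes). DEFINITION (letter). -/
def IsSNC (F : NCFrame N) : Prop :=
  IsStrictNormalCrossingsDivisor N.Y ((F.H : Set N.Y) ∪ ⋃ i, (F.D i : Set N.Y)) ∧
    IsIrreducible (F.H : Set N.Y) ∧ (∀ i, IsIrreducible (F.D i : Set N.Y)) ∧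
    (∀ i, ¬ (F.H : Set N.Y) ⊆ F.D i) ∧ (∀ i, ¬ (F.D i : Set N.Y) ⊆ F.H) ∧
    ∀ i j, i ≠ j → ¬ (F.D i : Set N.Y) ⊆ F.D j

/-- `F.IdealShape n` — THE IDEAL SHAPE: `𝓘 = 𝓘(H)ⁿ + Π 𝓘(Dᵢ)^{aᵢ}` as ideal sheaves (D₀ = `(x², z⁶w⁶) = (x)² + (z)⁶(w)⁶`,
D₁ = `(x², z⁴w²)`).  `hⁿ ∈ 𝓘`: SQUARE CONTACT IS PERMANENT — the shape and the frame survive every face blow-up (module docstring).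
DEFINITION (letter). -/
def IdealShape (n : ℕ) (F : NCFrame N) : Prop := N.I = (vanishingIdeal F.H) ^ n + F.boundary

/-- `F.HypShape n` — THE HYPERSURFACE SHAPE: along `H` the ideal is stalk-locally PRINCIPAL, generated by `hⁿ + u·m` with `u` a
UNIT, `h` a stalk generator of `𝓘(H)` and `m` one of `𝓜` (T₃ = `z³ + (tuw)⁴`: `h = z`, `m = (tuw)⁴`, `u = 1`; `x² + t·z⁶w⁶` with
`T : 1`).  KANGAROO-PRONE (module docstring: `x² + (1 + xz)·z²w²`). DEFINITION (letter). -/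
def HypShape (n : ℕ) (F : NCFrame N) : Prop :=
  ∀ y : N.Y, y ∈ (F.H : Set N.Y) →
    ∃ h m u : N.Y.presheaf.stalk y, IsUnit u ∧ stalkIdeal (vanishingIdeal F.H) y = Ideal.span {h} ∧
      stalkIdeal F.boundary y = Ideal.span {m} ∧ stalkIdeal N.I y = Ideal.span {h ^ n + u * m}

/-- `F.SuppLE n` — THE NON-DEGENERACY CLAUSE: the top locus `Supp(𝓘, n) = {y | ord_y 𝓘 ≥ n}` lies on `H` (automatic in the
ideal shape for `n ≥ 1`; in the hypersurface shape it fails exactly for the purely inseparable degenerate members, e.g.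
`x² + z⁶w⁶ = (x + z³w³)²` in char 2, whose top locus is the 3-fold `V(x + z³w³)`). DEFINITION (letter). -/
def SuppLE (n : ℕ) (F : NCFrame N) : Prop := ∀ y : N.Y, (n : ℕ∞) ≤ idealOrder N.I y → y ∈ (F.H : Set N.Y)

end NCFrame

/-- **`IsNCStage n N` — IDEAL-SHAPE LABELLED N.C.-MONOMIAL SQUARE-CONTACT STAGE at marking `n`**: an s.n.c. frame presenting the
ideal in the ideal shape, top locus on `H`.  THE DOMAIN OF THE g33 TRANSFER LEMMA: the top locus is READ OFF THE LABELS —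
`Supp = H ∩ {y | Σ_{Dᵢ ∋ y} aᵢ ≥ n}` — and the blow-up of a face `H ∩ ⋂_{i∈F} Dᵢ` with `Σ_F aᵢ ≥ n` is again an ideal-shape n.c.
stage, new component labelled `Σ_F aᵢ − n`, old labels kept (desk-verified in every chart; NOT proved here).
DEFINITION (letter · the transfer domain). -/
def IsNCStage (n : ℕ) (N : Stage) : Prop :=
  ∃ F : NCFrame N, F.IsSNC ∧ F.IdealShape n ∧ F.SuppLE n

/-- **`IsNCHypStage n N` — HYPERSURFACE-SHAPE LABELLED N.C.-MONOMIAL SQUARE-CONTACT STAGE at marking `n`** (T₃'s class at its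
frozen level).  The label rule holds (desk); STABILITY UNDER FACE BLOW-UPS FAILS at label-`0` births (the kangaroo desk negative of
the module docstring) — a frame-change theory is needed before any transfer. DEFINITION (letter · kangaroo-prone). -/
def IsNCHypStage (n : ℕ) (N : Stage) : Prop :=
  ∃ F : NCFrame N, F.IsSNC ∧ F.HypShape n ∧ F.SuppLE n

/-- **`IsNCRegime n N`** — the stage is in the N.C. REGIME: ideal shape or hypersurface shape. DEFINITION (letter). -/
def IsNCRegime (n : ℕ) (N : Stage) : Prop := IsNCStage n N ∨ IsNCHypStage n N

/-- `EverNC n R` — SOME level of the singular run out of the refined stage `R` is in the n.c. regime. DEFINITION (letter). -/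
def EverNC (n : ℕ) (R : RefStage) : Prop := ∃ i : ℕ, IsNCRegime n (sRun n R i).base

/-- a stage in the n.c. regime is `EverNC` at level `0`. [folklore] -/
theorem everNC_of_isNCRegime {n : ℕ} {R : RefStage} (h : IsNCRegime n R.base) : EverNC n R := ⟨0, h⟩

/-- `EverNC` passes DOWN one singular hop: if some level of the run out of the next stage is in the regime, so is some level of
the run out of the present one (`sRun_succ_front`). [folklore] -/
theorem everNC_of_everNC_next {n : ℕ} {R : RefStage} (h : EverNC n (sHop n R).next) : EverNC n R := by
  obtain ⟨i, hi⟩ := h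
  exact ⟨i + 1, by rw [sRun_succ_front]; exact hi⟩

end NCStage

section NCTransport

open Summit.ResolutionOfSingularities.ResolutionOfSingularities.Theorems
open WeakOrderReduction ForcedTowerClasses SubfieldContactClasses AbsoluteContactClasses PurityValveClasses

/-! ### §NCTransport — WEAK RESOLUTIONS DESCEND FROM ANY LEVEL OF THE SINGULAR RUN (all heights, hypothesis-free) -/

/-- **TRANSPORT DOWN THE SINGULAR RUN.**  For a base `n`-datum (nothing pending, or a pending curve inside its support) and any
height `i`: if EVERY presentation of level `i` of its singular run as a base `n`-datum has a weak resolution, then the datum has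
one — induction on `i` over the splice of `sHop_facts` and the tail identity `sRun_succ_front` (every centre of the prefix is
regular and inside the top locus: g30 §SEngine).  Generalises `wor_of_sTerminatesAt` (whose level-`h` input is the height-`0`
closing law); needs NO `SeqDimFour 5 n`. [new] [folklore] -/
theorem wor_of_wor_at_sRun {k : Type} [Field k] {n : ℕ} :
    ∀ (i : ℕ) {Y : Scheme.{0}} {g : Y ⟶ Spec (.of k)}, IsBase Y g → ∀ {M : MarkedIdeal Y}, IsDatum n M →
      ∀ P : Option (Closeds Y), (∀ S, P = some S → DimLEOne S ∧ (S : Set Y) ⊆ M.support) →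
      (∀ (Yᵢ : Scheme.{0}) (gᵢ : Yᵢ ⟶ Spec (.of k)) (Mᵢ : MarkedIdeal Yᵢ) (Pᵢ : Option (Closeds Yᵢ)),
          IsBase Yᵢ gᵢ → IsDatum n Mᵢ → sRun n ⟨⟨Y, M.ideal⟩, P⟩ i = ⟨⟨Yᵢ, Mᵢ.ideal⟩, Pᵢ⟩ →
          (∀ Sᵢ, Pᵢ = some Sᵢ → DimLEOne Sᵢ ∧ (Sᵢ : Set Yᵢ) ⊆ Mᵢ.support) → ∃ t' : CentreSeq Yᵢ, WeakResolution t' Mᵢ) →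
      ∃ t : CentreSeq Y, WeakResolution t M
  | 0, Y, g, hB, M, hM, P, hP, h => h Y g M P hB hM rfl hP
  | i + 1, Y, g, hB, M, hM, P, hP, h => by
    obtain ⟨Y₁, g₁, M₁, P₁, hB₁, hM₁, hS, hP₁, hsp⟩ := sHop_facts hB hM P hP
    refine hsp (wor_of_wor_at_sRun i hB₁ hM₁ P₁ hP₁ fun Yᵢ gᵢ Mᵢ Pᵢ hBᵢ hMᵢ e hPᵢ => ?_)
    refine h Yᵢ gᵢ Mᵢ Pᵢ hBᵢ hMᵢ ?_ hPᵢ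
    rw [sRun_succ_front, hS, e]

/-- **COROLLARY · ENTERING A LAWFUL CLASS SUFFICES**: if every base `n`-datum whose stage lies in a class `Q` has a weak resolution
(over the field `k`), then so does every base `n`-datum (nothing pending) SOME level of whose singular run lies in `Q`.
[new] [folklore] -/
theorem wor_of_ever {k : Type} [Field k] {n : ℕ} {Q : Stage → Prop}
    (hQ : ∀ (Y : Scheme.{0}) (g : Y ⟶ Spec (.of k)), IsBase Y g → ∀ M : MarkedIdeal Y, IsDatum n M →
      Q ⟨Y, M.ideal⟩ → ∃ t : CentreSeq Y, WeakResolution t M)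
    {Y : Scheme.{0}} {g : Y ⟶ Spec (.of k)} (hB : IsBase Y g) {M : MarkedIdeal Y} (hM : IsDatum n M)
    (hE : ∃ i : ℕ, Q (sRun n ⟨⟨Y, M.ideal⟩, none⟩ i).base) : ∃ t : CentreSeq Y, WeakResolution t M := by
  obtain ⟨i, hi⟩ := hE
  refine wor_of_wor_at_sRun i hB hM none (fun S h => (Option.some_ne_none S h.symm).elim) ?_
  intro Yᵢ gᵢ Mᵢ Pᵢ hBᵢ hMᵢ e _
  rw [e] at hi
  exact hQ Yᵢ gᵢ hBᵢ Mᵢ hMᵢ hi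

end NCTransport

section NCRing

/-! ### §NCRing — RING-LEVEL SHAPE PRESENTATIONS of the recorded inhabitants and THE KANGAROO CERTIFICATE (0-currency
documentation; the scheme-level letter instances are part of the transfer layer and are NOT claimed) -/

/-- D₀'s IDEAL SHAPE at ring level: `(x², z⁶w⁶) = (x)² + (z)⁶·(w)⁶` in any commutative ring (labels `Z:6, W:6`, `n = 2`).
[folklore] -/
theorem D0_ring_idealShape {R : Type*} [CommRing R] (x z w : R) :
    Ideal.span {x ^ 2, z ^ 6 * w ^ 6} = Ideal.span {x} ^ 2 + Ideal.span {z} ^ 6 * Ideal.span {w} ^ 6 := by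
  rw [Ideal.span_singleton_pow, Ideal.span_singleton_pow, Ideal.span_singleton_pow,
    Ideal.span_singleton_mul_span_singleton, Ideal.span_insert, Submodule.add_eq_sup]

/-- D₁'s IDEAL SHAPE at ring level: `(x², z⁴w²) = (x)² + (z)⁴·(w)²` (labels `Z:4, W:2`, `n = 2`). [folklore] -/
theorem D1_ring_idealShape {R : Type*} [CommRing R] (x z w : R) :
    Ideal.span {x ^ 2, z ^ 4 * w ^ 2} = Ideal.span {x} ^ 2 + Ideal.span {z} ^ 4 * Ideal.span {w} ^ 2 := by
  rw [Ideal.span_singleton_pow, Ideal.span_singleton_pow, Ideal.span_singleton_pow,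
    Ideal.span_singleton_mul_span_singleton, Ideal.span_insert, Submodule.add_eq_sup]

/-- T₃'s HYPERSURFACE SHAPE at ring level: `(z³ + (tuw)⁴) = (h³ + 1·m)` with `h = z` and `m = t⁴u⁴w⁴` THE generator of the
monomial ideal `(t)⁴(u)⁴(w)⁴` (labels `T:4, U:4, W:4`, `n = 3`, unit `u = 1`). [folklore] -/
theorem T3_ring_hypShape {R : Type*} [CommRing R] (z t u w : R) :
    Ideal.span {z ^ 3 + (t * u * w) ^ 4} = Ideal.span {z ^ 3 + 1 * (t ^ 4 * u ^ 4 * w ^ 4)} ∧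
      Ideal.span {t ^ 4 * u ^ 4 * w ^ 4} = Ideal.span {t} ^ 4 * Ideal.span {u} ^ 4 * Ideal.span {w} ^ 4 := by
  refine ⟨by rw [one_mul, mul_pow, mul_pow], ?_⟩
  rw [Ideal.span_singleton_pow, Ideal.span_singleton_pow, Ideal.span_singleton_pow,
    Ideal.span_singleton_mul_span_singleton, Ideal.span_singleton_mul_span_singleton]

/-- **THE KANGAROO CERTIFICATE (desk negative for the hypersurface shape, ring level).**  In characteristic 2, for
`f = x² + (1 + xz)·z²w²` (hypersurface shape, frame `(V(x); Z:2, W:2)`, `n = 2`) and the blow-up of the face `V(x, z)` read in the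
`x`-chart `z = z₁·x₁`, `x = x₁`: (i) `f = x₁² · f₁` with the controlled transform `f₁ = 1 + z₁²w² + x₁²z₁³w²`; (ii) `f₁` lies in the
SQUARE of the ideal `(x₁, 1 + z₁w)`, hence has order `≥ 2 = n` at every point of the surface `{x₁ = 0, z₁w = 1} ⊂ E`, which is off
the strict transform `H′` (empty on this chart) and off every positively labelled boundary component: the top locus has left the
square-contact hypersurface along the NEW contact hypersurface `V(1 + z₁w)`. [new] [folklore] -/
theorem kangaroo_ring_cert {R : Type*} [CommRing R] [CharP R 2] (x₁ z₁ w : R) :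
    x₁ ^ 2 + (1 + x₁ * (z₁ * x₁)) * (z₁ * x₁) ^ 2 * w ^ 2 = x₁ ^ 2 * (1 + z₁ ^ 2 * w ^ 2 + x₁ ^ 2 * z₁ ^ 3 * w ^ 2) ∧
      1 + z₁ ^ 2 * w ^ 2 + x₁ ^ 2 * z₁ ^ 3 * w ^ 2 ∈ (Ideal.span {x₁, 1 + z₁ * w}) ^ 2 := by
  refine ⟨by ring, ?_⟩
  have h2 : (2 : R) = 0 := CharP.cast_eq_zero R 2
  have hx : x₁ ∈ Ideal.span ({x₁, 1 + z₁ * w} : Set R) := Ideal.subset_span (by simp)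
  have hq : 1 + z₁ * w ∈ Ideal.span ({x₁, 1 + z₁ * w} : Set R) := Ideal.subset_span (by simp)
  have e : 1 + z₁ ^ 2 * w ^ 2 + x₁ ^ 2 * z₁ ^ 3 * w ^ 2 =
      (1 + z₁ * w) * (1 + z₁ * w) + x₁ * (x₁ * (z₁ ^ 3 * w ^ 2)) - 2 * (z₁ * w) := by ring
  rw [e, h2, zero_mul, sub_zero, pow_two]
  exact Ideal.add_mem _ (Ideal.mul_mem_mul hq hq)
    (Ideal.mul_mem_mul hx (Ideal.mul_mem_right _ _ hx))

end NCRing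

end Summit.ResolutionOfSingularities.ResolutionOfSingularities.Theorems.DeltaCutClasses
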